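import Summits.RiemannHypothesis.RiemannHypothesis.Theorems.GroundBartaEvenWinsBeyondArchDeflationCrossGlue
import HarnessLib

/-!
# RiemannHypothesis / GroundBarta — rung 4 (`EvenWinsBeyondArch`, stmt-RiemannHypothesis-18807 / 18085):
# the deflated Temple L-side — cross terms: `∫ Re = Re ∫` and conjugation symmetry

Helper file (`--supports stmt-RiemannHypothesis-18807`), RH-free, no facts.  Prover B, speedrun unit `sr-gb-rung-b` (gen 4).
Prover A's `dt_m77_oddLower_of_gramT` states the cross boxes for `∫ Re(r_i r̄_j)`; the R-layer certifies `Re ∫ r_i r̄_j`.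
Here: the cross density `r_i r̄_j` of two residuals is integrable (polarisation of two `L²` functions), hence the two agree,
and `Re ∫ r_j r̄_i = Re ∫ r_i r̄_j`.
-/

set_option linter.dupNamespace false

noncomputable section

open MeasureTheory Set Filter intervalIntegral
open scoped Topology BigOperators ComplexConjugate

namespace Summit.RiemannHypothesis.RiemannHypothesis.Theorems.EvenWinsBeyondArch

open Literature.NumberTheory.LFunctions
open Literature.Analysis.ValidatedNumerics Literature.Analysis.ValidatedNumerics.PolyMP
  Literature.Analysis.ValidatedNumerics.NumericsMP Literature.Analysis.ValidatedNumerics.ExpPoly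

section CrossRe

variable {c : ℝ} {k : ℕ}

/-- The cross density `r_i r̄_j` of two residuals is integrable. -/
theorem dt_residual_cross_integrable (hc : 0 < c)
    (g : Fin k → ℝ → ℝ) (hg : ∀ i, ContDiff ℝ 2 (g i))
    (v F : Fin k → ℝ → ℂ) (hv : ∀ i x, v i x = (((Icc (-c) c).indicator (g i) x : ℝ) : ℂ))
    (hF : ∀ i y, F i y = (Icc (-c) c).indicator (fun y ↦
        2 * (∫ x, v i x * (Real.cosh (x / 2) : ℂ)) * (Real.cosh (y / 2) : ℂ) -
          2 * (∫ x, v i x * (Real.sinh (x / 2) : ℂ)) * (Real.sinh (y / 2) : ℂ) +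
        (∑ n ∈ weilPrimeIndex c, (((ArithmeticFunction.vonMangoldt n : ℝ) / Real.sqrt n : ℝ) : ℂ) *
          (2 * v i y - v i (y - Real.log n) - v i (y + Real.log n))) +
        ∫ t in Ioi 0, (weilArchDensity t : ℂ) * (2 * v i y - v i (y - t) - v i (y + t))) y -
      (weilMarkovConstant c : ℂ) * v i y)
    (W : Fin k → Fin k → ℝ) (i j : Fin k) :
    Integrable fun y ↦ (F i - ∑ l, W i l • v l) y * conj ((F j - ∑ l, W j l • v l) y) := by
  have hmi : MemLp (F i - ∑ l, W i l • v l) 2 := dt_residual_memLp hc g hg v F hv hF W i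
  have hmk : MemLp (F j - ∑ l, W j l • v l) 2 := dt_residual_memLp hc g hg v F hv hF W j
  have hIi : Integrable fun y ↦ ‖(F i - ∑ l, W i l • v l) y‖ ^ 2 := (memLp_two_iff_integrable_sq_norm hmi.1).1 hmi
  have hIk : Integrable fun y ↦ ‖(F j - ∑ l, W j l • v l) y‖ ^ 2 := (memLp_two_iff_integrable_sq_norm hmk.1).1 hmk
  refine Integrable.mono' ((hIi.add hIk).div_const 2)
    (hmi.1.mul (Complex.continuous_conj.comp_aestronglyMeasurable hmk.1)) ?_
  refine Filter.Eventually.of_forall fun y ↦ ?_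
  change ‖(F i - ∑ l, W i l • v l) y * conj ((F j - ∑ l, W j l • v l) y)‖ ≤
    (‖(F i - ∑ l, W i l • v l) y‖ ^ 2 + ‖(F j - ∑ l, W j l • v l) y‖ ^ 2) / 2
  rw [norm_mul, Complex.norm_conj]
  nlinarith [sq_nonneg (‖(F i - ∑ l, W i l • v l) y‖ - ‖(F j - ∑ l, W j l • v l) y‖)]

/-- `∫ Re(r_i r̄_j) = Re ∫ r_i r̄_j`. -/
theorem dt_residual_cross_integral_re (hc : 0 < c)
    (g : Fin k → ℝ → ℝ) (hg : ∀ i, ContDiff ℝ 2 (g i))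
    (v F : Fin k → ℝ → ℂ) (hv : ∀ i x, v i x = (((Icc (-c) c).indicator (g i) x : ℝ) : ℂ))
    (hF : ∀ i y, F i y = (Icc (-c) c).indicator (fun y ↦
        2 * (∫ x, v i x * (Real.cosh (x / 2) : ℂ)) * (Real.cosh (y / 2) : ℂ) -
          2 * (∫ x, v i x * (Real.sinh (x / 2) : ℂ)) * (Real.sinh (y / 2) : ℂ) +
        (∑ n ∈ weilPrimeIndex c, (((ArithmeticFunction.vonMangoldt n : ℝ) / Real.sqrt n : ℝ) : ℂ) *
          (2 * v i y - v i (y - Real.log n) - v i (y + Real.log n))) +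
        ∫ t in Ioi 0, (weilArchDensity t : ℂ) * (2 * v i y - v i (y - t) - v i (y + t))) y -
      (weilMarkovConstant c : ℂ) * v i y)
    (W : Fin k → Fin k → ℝ) (i j : Fin k) :
    ∫ y, ((F i - ∑ l, W i l • v l) y * conj ((F j - ∑ l, W j l • v l) y)).re =
      (∫ y, (F i - ∑ l, W i l • v l) y * conj ((F j - ∑ l, W j l • v l) y)).re := by
  have h := integral_re (dt_residual_cross_integrable hc g hg v F hv hF W i j)
  simp only [RCLike.re_to_complex] at h
  exact h

/-- Conjugation symmetry of the real cross term: `Re ∫ r_j r̄_i = Re ∫ r_i r̄_j`. -/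
theorem dt_cross_re_symm (f g : ℝ → ℂ) :
    (∫ y, g y * conj (f y)).re = (∫ y, f y * conj (g y)).re := by
  have e : (fun y ↦ g y * conj (f y)) = fun y ↦ conj (f y * conj (g y)) := by
    funext y; rw [map_mul, Complex.conj_conj]; ring
  rw [e, integral_conj, Complex.conj_re]

end CrossRe

section CrossReL

variable {c : ℚ} {k : ℕ} {gp : Fin k → Poly} {v F : Fin k → ℝ → ℂ}

/-- `∫ Re = Re ∫` for the residual cross terms of polynomial window vectors (the R-layer's hypotheses `hv`, `hF`). -/
theorem dt_cross_integral_re_L (hc : 0 < c)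
    (hv : ∀ i x, v i x = (((Icc (-(c : ℝ)) c).indicator (fun x ↦ Poly.eval (gp i) x) x : ℝ) : ℂ))
    (hF : ∀ i y, F i y = (Icc (-(c : ℝ)) c).indicator (fun y ↦
        2 * (∫ x, v i x * (Real.cosh (x / 2) : ℂ)) * (Real.cosh (y / 2) : ℂ) -
          2 * (∫ x, v i x * (Real.sinh (x / 2) : ℂ)) * (Real.sinh (y / 2) : ℂ) +
        (∑ n ∈ weilPrimeIndex (c : ℝ), (((ArithmeticFunction.vonMangoldt n : ℝ) / Real.sqrt n : ℝ) : ℂ) *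
          (2 * v i y - v i (y - Real.log n) - v i (y + Real.log n))) +
        ∫ t in Ioi 0, (weilArchDensity t : ℂ) * (2 * v i y - v i (y - t) - v i (y + t))) y -
      (weilMarkovConstant (c : ℝ) : ℂ) * v i y)
    (W : Fin k → Fin k → ℝ) (i j : Fin k) :
    ∫ y, ((F i - ∑ l, W i l • v l) y * conj ((F j - ∑ l, W j l • v l) y)).re =
      (∫ y, (F i - ∑ l, W i l • v l) y * conj ((F j - ∑ l, W j l • v l) y)).re :=
  dt_residual_cross_integral_re (by exact_mod_cast hc) (fun l x ↦ Poly.eval (gp l) x) (fun l ↦ dt_contDiff_polyEval (gp l))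
    v F hv hF W i j

end CrossReL

end Summit.RiemannHypothesis.RiemannHypothesis.Theorems.EvenWinsBeyondArch

end
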